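import Summits.AnomalousDissipation.AnomalousDissipation.Theorems.SolenoidalFractalHomogenisationLagrangianStepSidebandConjGenFrame
import Summits.AnomalousDissipation.AnomalousDissipation.Theorems.SolenoidalFractalHomogenisationLagrangianStepSidebandLinearFrame
import Summits.AnomalousDissipation.AnomalousDissipation.Theorems.SolenoidalFractalHomogenisationLagrangianStepSidebandReal
import HarnessLib

/-!
# K1L_D `LagrangianRenormalisationStepDesign` (stmt-AnomalousDissipation-27980), registered stub `stub_D1_V0thg` (v28, ruling D28-3 (3)), port-map layer L4:
# the FROZEN-FRAME feedback matrices are REAL — `Im((M^θ_{jj'} e_l)_i) = 0` (helper; `--supports stmt-AnomalousDissipation-27980 --as helper`)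

Summits-side helper file of route `SolenoidalFractalHomogenisation` (prover seat `ad-k1l-cellLawV-w1` g9; port map
`Cruxes/LagrangianRenormalisationStepDesign/Lines/onelevel-vtheta-twist-portmap.md` §3 L4, ruling D28-7).  The frozen-frame twin of `…SidebandReal`
(`conjVec_single` is flat and REUSED BY NAME).  Everything proved; no definitions, no named facts, no sorry.
* `periodic_vector_solution_unique_frame` — uniqueness of periodic vector solutions of `n' = sourceθⱼ(t) v + genθ(t) n` (energy at the twisted rate
  `min γ₁ (4π² lo' c)`, `real_inner_genθ_le`);
* **`responseθ_conjVec`** — `(responseθ t (conj v))_z = −conj ((responseθ t v)_{−z})` (uniqueness + `genCompθ_conjFlip` + `sourceCompθ_conjVec`);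
* **`meanFeedbackθ_conjVec`**, **`im_meanFeedbackθ_single_apply`** — `M^θ_{jj'} (conj v) = conj (M^θ_{jj'} v)`, hence `Im((M^θ_{jj'} e_l)_i) = 0`: the `Re` in
  `psiStarθ` loses nothing.
At `G₀ = 1` these are literally the flat statements (`responseθ_one`, `meanFeedbackθ_one`).
NOT a proof of any registered stub, of the crux, or of anomalous dissipation; rung F-D1 infrastructure for the `stub_D1_V0thg` engine (L5 `…SidebandXEffGenPsiStarFrame`).
-/

set_option linter.dupNamespace false

noncomputable section

namespace Summit.AnomalousDissipation.AnomalousDissipation.Theorems.SolenoidalFractalHomogenisation.LagrangianStep.Sideband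

open Set MeasureTheory Complex UnitAddTorus Filter Topology
open scoped InnerProductSpace ComplexConjugate
open Literature.Analysis Literature.Analysis.FunctionSpaces Literature.Analysis.FunctionSpaces.Torus
open Literature.Analysis.FluidPDE Literature.Analysis.FluidPDE.Torus Literature.Analysis.FluidPDE.LatticeShear
open Summit.AnomalousDissipation.AnomalousDissipation.Theorems.SolenoidalFractalHomogenisation.PermissibleCarrier (period_pos)

variable {k₀ : ℕ}

/-- **Uniqueness of periodic vector solutions** of `n' = sourceⱼ(t) v + gen(t) n` on one period. [cite: SandersVerhulstMurdock2007, Lemma 5.2.7 (linear case)] -/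
theorem periodic_vector_solution_unique_frame (W₁ : LatticeWord k₀) {𝔸 : Torus.Visc4 (Fin 3)} {lo' hi' : ℝ} (h𝔸 : Torus.NearIso 𝔸 lo' hi') (hlo' : 0 < lo')
    (G₀ : Matrix (Fin 3) (Fin 3) ℝ) {c : ℝ} (hc : 0 < c) (hG : ∀ k : Fin 3 → ℤ, c * freqNormSq k ≤ ∑ a, twistFreq G₀ k a ^ 2)
    {γ₁ : ℝ} (hγ₁ : 0 < γ₁) {R : ℕ} {j : Fin k₀} {v : EuclideanSpace ℂ (Fin 3)} {n₁ n₂ : ℝ → Space R}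
    (hc₁ : ContinuousOn n₁ (Icc 0 W₁.period)) (hc₂ : ContinuousOn n₂ (Icc 0 W₁.period))
    (hd₁ : ∀ t ∈ Ico 0 W₁.period, HasDerivAt n₁ (sourceθ W₁ G₀ R j t v + genθ W₁ 𝔸 G₀ γ₁ R t (n₁ t)) t)
    (hd₂ : ∀ t ∈ Ico 0 W₁.period, HasDerivAt n₂ (sourceθ W₁ G₀ R j t v + genθ W₁ 𝔸 G₀ γ₁ R t (n₂ t)) t)
    (hp₁ : n₁ W₁.period = n₁ 0) (hp₂ : n₂ W₁.period = n₂ 0) :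
    ∀ t ∈ Icc 0 W₁.period, n₁ t = n₂ t := by
  have hP : 0 < W₁.period := period_pos W₁
  set γ : ℝ := min γ₁ (4 * Real.pi ^ 2 * (lo' * c)) with hγdef
  have hγ : 0 < γ := lt_min hγ₁ (by positivity)
  have hD : ∀ t ∈ Ico 0 W₁.period, HasDerivAt (fun s => n₁ s - n₂ s) (genθ W₁ 𝔸 G₀ γ₁ R t (n₁ t - n₂ t)) t := by
    intro t ht
    have h := (hd₁ t ht).sub (hd₂ t ht)
    refine h.congr_deriv ?_
    rw [map_sub]; abel
  set φ : ℝ → ℝ := fun s => ‖n₁ s - n₂ s‖ ^ 2 with hφ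
  set ψ : ℝ → ℝ := fun s => Real.exp (2 * γ * s) * φ s with hψ
  have hφd : ∀ t ∈ Ico 0 W₁.period, HasDerivAt φ (2 * ⟪n₁ t - n₂ t, genθ W₁ 𝔸 G₀ γ₁ R t (n₁ t - n₂ t)⟫_ℝ) t :=
    fun t ht => (hD t ht).norm_sq
  have hφb : ∀ t ∈ Ico 0 W₁.period, 2 * ⟪n₁ t - n₂ t, genθ W₁ 𝔸 G₀ γ₁ R t (n₁ t - n₂ t)⟫_ℝ ≤ -(2 * γ) * φ t := by
    intro t ht
    rw [real_inner_comm]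
    have h := real_inner_genθ_le W₁ h𝔸 hlo'.le G₀ hc.le hG γ₁ R t (n₁ t - n₂ t)
    have hφt : φ t = ‖n₁ t - n₂ t‖ ^ 2 := rfl
    rw [hφt]
    linarith
  have hφc : ContinuousOn φ (Icc 0 W₁.period) := ((hc₁.sub hc₂).norm).pow 2
  have hψc : ContinuousOn ψ (Icc 0 W₁.period) := (Real.continuous_exp.comp (continuous_const.mul continuous_id)).continuousOn.mul hφc
  have hψd : ∀ t ∈ Ico 0 W₁.period, HasDerivAt ψ (Real.exp (2 * γ * t) * (2 * γ) * φ t +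
      Real.exp (2 * γ * t) * (2 * ⟪n₁ t - n₂ t, genθ W₁ 𝔸 G₀ γ₁ R t (n₁ t - n₂ t)⟫_ℝ)) t := by
    intro t ht
    have he : HasDerivAt (fun s => Real.exp (2 * γ * s)) (Real.exp (2 * γ * t) * (2 * γ)) t := by
      have := ((hasDerivAt_id t).const_mul (2 * γ)).exp
      simpa using this
    exact he.mul (hφd t ht)
  have hanti : AntitoneOn ψ (Icc 0 W₁.period) := by
    refine antitoneOn_of_deriv_nonpos (convex_Icc 0 W₁.period) hψc ?_ ?_
    · rw [interior_Icc]
      intro t ht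
      exact (hψd t ⟨ht.1.le, ht.2⟩).differentiableAt.differentiableWithinAt
    · rw [interior_Icc]
      intro t ht
      rw [(hψd t ⟨ht.1.le, ht.2⟩).deriv]
      have h := hφb t ⟨ht.1.le, ht.2⟩
      have hpos : 0 < Real.exp (2 * γ * t) := Real.exp_pos _
      nlinarith
  have hφP : φ W₁.period = φ 0 := by simp only [hφ, hp₁, hp₂]
  have hφ0 : φ 0 = 0 := by
    have h1 : ψ W₁.period ≤ ψ 0 := hanti ⟨le_rfl, hP.le⟩ ⟨hP.le, le_rfl⟩ hP.le
    simp only [hψ, mul_zero, Real.exp_zero, one_mul, hφP] at h1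
    have hgt : 1 < Real.exp (2 * γ * W₁.period) := Real.one_lt_exp_iff.2 (by positivity)
    have hnn : 0 ≤ φ 0 := sq_nonneg _
    nlinarith
  intro t ht
  have h1 : ψ t ≤ ψ 0 := hanti ⟨le_rfl, hP.le⟩ ht ht.1
  simp only [hψ, mul_zero, Real.exp_zero, hφ0] at h1
  have hpos : 0 < Real.exp (2 * γ * t) := Real.exp_pos _
  have hφt : φ t = 0 := le_antisymm (by nlinarith [sq_nonneg ‖n₁ t - n₂ t‖]) (sq_nonneg _)
  have : ‖n₁ t - n₂ t‖ = 0 := by simpa [hφ] using hφt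
  exact sub_eq_zero.1 (norm_eq_zero.1 this)

/-- **CONJUGATION SYMMETRY OF THE PERIODIC RESPONSE**: for `t ∈ [0,P]` and every `z ∈ box`,
`(response t (conj v))_z = −conj ((response t v)_{−z})` — the response inherits the real structure of the system (uniqueness of periodic vector solutions
+ `genComp_conjFlip` + `sourceComp_conjVec`). [cite: SandersVerhulstMurdock2007, Lemma 5.2.7 (linear case)] [cite: MajdaKramer1999, §2.2.1.3] -/
theorem responseθ_conjVec (W₁ : LatticeWord k₀) {𝔸 : Torus.Visc4 (Fin 3)} {lo' hi' : ℝ} (h𝔸 : Torus.NearIso 𝔸 lo' hi') (hlo' : 0 < lo')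
    (G₀ : Matrix (Fin 3) (Fin 3) ℝ) {c : ℝ} (hc : 0 < c) (hG : ∀ k : Fin 3 → ℤ, c * freqNormSq k ≤ ∑ a, twistFreq G₀ k a ^ 2)
    {γ₁ : ℝ} (hγ₁ : 0 < γ₁) (R : ℕ) (j : Fin k₀) (v : EuclideanSpace ℂ (Fin 3)) {t : ℝ} (ht : t ∈ Icc 0 W₁.period) (z : box R) :
    responseθ W₁ 𝔸 G₀ γ₁ R j t v z = -EuclideanSpace.conjVec (responseθ W₁ 𝔸 G₀ γ₁ R j t (EuclideanSpace.conjVec v) ⟨-z.1, neg_mem_box z.2⟩) := by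
  have hN := isPeriodicResponseθ_responseθ_of_nearIso W₁ h𝔸 hlo' G₀ hc hG hγ₁ R j
  obtain ⟨hcN, hdN, hpN⟩ := hN
  set N := responseθ W₁ 𝔸 G₀ γ₁ R j with hNdef
  -- the flip as a real continuous linear map (a term, not a definition)
  set JL : Space R →L[ℝ] Space R :=
    ((PiLp.continuousLinearEquiv 2 ℝ (fun _ : box R => EuclideanSpace ℂ (Fin 3))).symm : (box R → EuclideanSpace ℂ (Fin 3)) →L[ℝ] Space R).comp
      (ContinuousLinearMap.pi fun z' : box R =>
        -((EuclideanSpace.conjVecL).comp ((PiLp.proj (𝕜 := ℂ) 2 (fun _ : box R => EuclideanSpace ℂ (Fin 3)) ⟨-z'.1, neg_mem_box z'.2⟩).restrictScalars ℝ)))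
    with hJLdef
  have hJL : ∀ w : Space R, JL w = WithLp.toLp 2 (fun z' : box R => -EuclideanSpace.conjVec (w ⟨-z'.1, neg_mem_box z'.2⟩)) := by
    intro w
    refine PiLp.ext fun z' => ?_
    simp [hJLdef]
  have hJLz : ∀ (w : Space R) (z' : box R), JL w z' = -EuclideanSpace.conjVec (w ⟨-z'.1, neg_mem_box z'.2⟩) := by
    intro w z'; rw [hJL]
  -- the flipped curve
  set n₂ : ℝ → Space R := fun s => JL (N s (EuclideanSpace.conjVec v)) with hn₂
  have hc₂ : ContinuousOn n₂ (Icc 0 W₁.period) := JL.continuous.comp_continuousOn (hcN.clm_apply continuousOn_const)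
  have hd₂ : ∀ s ∈ Ico 0 W₁.period, HasDerivAt n₂ (sourceθ W₁ G₀ R j s v + genθ W₁ 𝔸 G₀ γ₁ R s (n₂ s)) s := by
    intro s hs
    have h1 : HasDerivAt (fun s => N s (EuclideanSpace.conjVec v))
        ((sourceθ W₁ G₀ R j s).restrictScalars ℝ (EuclideanSpace.conjVec v) +
          (((genθ W₁ 𝔸 G₀ γ₁ R s).restrictScalars ℝ).comp (N s)) (EuclideanSpace.conjVec v)) s := by
      have h0 := (hdN s hs).clm_apply (hasDerivAt_const s (EuclideanSpace.conjVec v))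
      refine h0.congr_deriv ?_
      rw [map_zero, add_zero, add_apply]
    have h2 := JL.hasFDerivAt.comp_hasDerivAt s h1
    refine h2.congr_deriv ?_
    refine PiLp.ext fun z' => ?_
    rw [hJLz]
    simp only [ContinuousLinearMap.coe_restrictScalars', ContinuousLinearMap.comp_apply, PiLp.add_apply, sourceθ_apply, genθ_apply,
      EuclideanSpace.conjVec_add, neg_add]
    have hz'' : (⟨-(⟨-z'.1, neg_mem_box z'.2⟩ : box R).1, neg_mem_box (⟨-z'.1, neg_mem_box z'.2⟩ : box R).2⟩ : box R) = z' :=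
      Subtype.ext (by simp)
    rw [sourceCompθ_conjVec, hz'', EuclideanSpace.conjVec_neg, EuclideanSpace.conjVec_conjVec, neg_neg]
    congr 1
    have hg := genCompθ_conjFlip W₁ 𝔸 G₀ γ₁ R s z' (N s (EuclideanSpace.conjVec v))
    rw [← hJL] at hg
    rw [← hg]
  have hp₂ : n₂ W₁.period = n₂ 0 := by simp only [hn₂, hpN]
  -- the straight curve
  have hc₁ : ContinuousOn (fun s => N s v) (Icc 0 W₁.period) := hcN.clm_apply continuousOn_const
  have hd₁ : ∀ s ∈ Ico 0 W₁.period, HasDerivAt (fun s => N s v) (sourceθ W₁ G₀ R j s v + genθ W₁ 𝔸 G₀ γ₁ R s (N s v)) s := by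
    intro s hs
    have h0 := (hdN s hs).clm_apply (hasDerivAt_const s v)
    refine h0.congr_deriv ?_
    rw [map_zero, add_zero, add_apply, ContinuousLinearMap.comp_apply, ContinuousLinearMap.coe_restrictScalars',
      ContinuousLinearMap.coe_restrictScalars']
  have hp₁ : (fun s => N s v) W₁.period = (fun s => N s v) 0 := by simp only [hpN]
  have heq := periodic_vector_solution_unique_frame W₁ h𝔸 hlo' G₀ hc hG hγ₁ hc₁ hc₂ hd₁ hd₂ hp₁ hp₂ t ht
  have := congrArg (fun w : Space R => w z) heq
  simpa only [hn₂, hJLz] using this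

/-- **The feedback matrices commute with conjugation**: `M_{jj'} (conj v) = conj (M_{jj'} v)`. [cite: MajdaKramer1999, §2.2.1.3 (55)] -/
theorem meanFeedbackθ_conjVec (W₁ : LatticeWord k₀) {𝔸 : Torus.Visc4 (Fin 3)} {lo' hi' : ℝ} (h𝔸 : Torus.NearIso 𝔸 lo' hi') (hlo' : 0 < lo')
    (G₀ : Matrix (Fin 3) (Fin 3) ℝ) {c : ℝ} (hc : 0 < c) (hG : ∀ k : Fin 3 → ℤ, c * freqNormSq k ≤ ∑ a, twistFreq G₀ k a ^ 2)
    {γ₁ : ℝ} (hγ₁ : 0 < γ₁) (R : ℕ) (j j' : Fin k₀) (v : EuclideanSpace ℂ (Fin 3)) :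
    meanFeedbackθ W₁ 𝔸 G₀ γ₁ R j j' (EuclideanSpace.conjVec v) = EuclideanSpace.conjVec (meanFeedbackθ W₁ 𝔸 G₀ γ₁ R j j' v) := by
  have hP : 0 < W₁.period := period_pos W₁
  have hN := isPeriodicResponseθ_responseθ_of_nearIso W₁ h𝔸 hlo' G₀ hc hG hγ₁ R j'
  have hcont : ContinuousOn (fun t => ((feedback W₁ R j t).restrictScalars ℝ).comp (responseθ W₁ 𝔸 G₀ γ₁ R j' t)) (Icc 0 W₁.period) := by
    rw [continuousOn_clm_apply]
    intro w
    have h1 : ContinuousOn (fun t => responseθ W₁ 𝔸 G₀ γ₁ R j' t w) (Icc 0 W₁.period) := hN.1.clm_apply continuousOn_const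
    have h2 : Continuous (fun t => (feedback W₁ R j t).restrictScalars ℝ) := by
      rw [continuous_clm_apply]
      intro w
      exact ((continuous_clm_apply.1 (continuous_feedback W₁ R j)) w).congr fun t => rfl
    exact (h2.continuousOn.clm_apply h1).congr fun t _ => rfl
  have hint : IntegrableOn (fun t => ((feedback W₁ R j t).restrictScalars ℝ).comp (responseθ W₁ 𝔸 G₀ γ₁ R j' t)) (Ioc 0 W₁.period) volume :=
    (hcont.integrableOn_compact isCompact_Icc).mono_set Ioc_subset_Icc_self
  -- pointwise: the flipped response and the feedback
  have hpt : ∀ t ∈ Ioc 0 W₁.period, (((feedback W₁ R j t).restrictScalars ℝ).comp (responseθ W₁ 𝔸 G₀ γ₁ R j' t)) (EuclideanSpace.conjVec v) =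
      EuclideanSpace.conjVecL ((((feedback W₁ R j t).restrictScalars ℝ).comp (responseθ W₁ 𝔸 G₀ γ₁ R j' t)) v) := by
    intro t ht
    have hflip : responseθ W₁ 𝔸 G₀ γ₁ R j' t (EuclideanSpace.conjVec v) =
        WithLp.toLp 2 (fun z' : box R => -EuclideanSpace.conjVec (responseθ W₁ 𝔸 G₀ γ₁ R j' t v ⟨-z'.1, neg_mem_box z'.2⟩)) := by
      refine PiLp.ext fun z' => ?_
      have h := responseθ_conjVec W₁ h𝔸 hlo' G₀ hc hG hγ₁ R j' (EuclideanSpace.conjVec v) (Ioc_subset_Icc_self ht) z'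
      rw [EuclideanSpace.conjVec_conjVec] at h
      rw [h]
    rw [ContinuousLinearMap.comp_apply, ContinuousLinearMap.comp_apply]
    show feedback W₁ R j t (responseθ W₁ 𝔸 G₀ γ₁ R j' t (EuclideanSpace.conjVec v)) =
      EuclideanSpace.conjVecL (feedback W₁ R j t (responseθ W₁ 𝔸 G₀ γ₁ R j' t v))
    rw [hflip, feedback_conjFlip, EuclideanSpace.conjVecL_apply]
  have hI : ∫ t in Ioc 0 W₁.period, (((feedback W₁ R j t).restrictScalars ℝ).comp (responseθ W₁ 𝔸 G₀ γ₁ R j' t)) (EuclideanSpace.conjVec v) =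
      ∫ t in Ioc 0 W₁.period, EuclideanSpace.conjVecL ((((feedback W₁ R j t).restrictScalars ℝ).comp (responseθ W₁ 𝔸 G₀ γ₁ R j' t)) v) :=
    setIntegral_congr_fun measurableSet_Ioc hpt
  have hintv : Integrable (fun t => (((feedback W₁ R j t).restrictScalars ℝ).comp (responseθ W₁ 𝔸 G₀ γ₁ R j' t)) v)
      (volume.restrict (Ioc 0 W₁.period)) :=
    (ContinuousLinearMap.apply ℝ (EuclideanSpace ℂ (Fin 3)) v).integrable_comp hint
  rw [meanFeedbackθ, smul_apply, smul_apply, intervalIntegral.integral_of_le hP.le, ContinuousLinearMap.integral_apply hint,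
    ContinuousLinearMap.integral_apply hint, hI, ContinuousLinearMap.integral_comp_comm _ hintv, EuclideanSpace.conjVecL_apply,
    ← EuclideanSpace.conjVecL_apply, ← EuclideanSpace.conjVecL_apply, map_smul]

/-- **THE FEEDBACK MATRICES ARE REAL**: `Im ((M_{jj'} e_l)_i) = 0` — so the `Re` in `psiStar` (tenure D26-3, proviso P3) loses nothing.
[cite: MajdaKramer1999, §2.2.1.3 (55)] -/
theorem im_meanFeedbackθ_single_apply (W₁ : LatticeWord k₀) {𝔸 : Torus.Visc4 (Fin 3)} {lo' hi' : ℝ} (h𝔸 : Torus.NearIso 𝔸 lo' hi') (hlo' : 0 < lo')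
    (G₀ : Matrix (Fin 3) (Fin 3) ℝ) {c : ℝ} (hc : 0 < c) (hG : ∀ k : Fin 3 → ℤ, c * freqNormSq k ≤ ∑ a, twistFreq G₀ k a ^ 2)
    {γ₁ : ℝ} (hγ₁ : 0 < γ₁) (R : ℕ) (j j' : Fin k₀) (l i : Fin 3) :
    ((meanFeedbackθ W₁ 𝔸 G₀ γ₁ R j j' (EuclideanSpace.single l (1:ℂ))) i).im = 0 := by
  have h := meanFeedbackθ_conjVec W₁ h𝔸 hlo' G₀ hc hG hγ₁ R j j' (EuclideanSpace.single l (1:ℂ))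
  rw [conjVec_single] at h
  have hi := congrArg (fun w : EuclideanSpace ℂ (Fin 3) => w i) h
  simp only [EuclideanSpace.conjVec_apply] at hi
  exact Complex.conj_eq_iff_im.1 hi.symm

end Summit.AnomalousDissipation.AnomalousDissipation.Theorems.SolenoidalFractalHomogenisation.LagrangianStep.Sideband

end
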